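import Literature.RepresentationTheory.KonnoKonno2007.JunctionDetCharacters
import Literature.RepresentationTheory.KonnoKonno2007.JunctionContinuityKAK
import HarnessLib

/-!
# The junction at a DEFINITE place: the whole real unitary group acts on the vacuum of every archimedean
# Weil datum by a power of the determinant (kernel, 0 records)

Topic `RepresentationTheory/KonnoKonno2007`; namespace `Literature.RepresentationTheory.KonnoKonno2007.RealDualPair`.
Continues `RealUnitaryDualPair` / `JunctionContinuityKAK` (the concrete junction `junction P Q R S` of the real unitary dual pair
`U(P,Q) × U(R,S) → Sp(𝕎)` in the tree's block coordinates) and `JunctionVacuumExponents` /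
`JunctionDetCharacters` (every archimedean Weil datum over a junction has the Gaussian `h₀ = hermitePi 0` as a
`K_V × K_W`-eigenvector with a four-determinant-power character; the determinant characters `detVChar`,
`detWChar` of `G_∞`).

At a DEFINITE hermitian space the maximal compact is the whole group.  In the tree's frames this reads: when the
negative block `Q` is EMPTY (resp. the positive block `P` is empty) the block-diagonal inclusion
`kV : U(P) × U(Q) →* U(P,Q)` of `RealUnitaryDualPair` is SURJECTIVE (the tree's
`UForm.kV_surjective_of_isEmpty_right/left` of `JunctionContinuityKAK` §2; §1 here only adds the disjunctive form and
`det diag(a,b) = det a · det b`).  Hence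
(§2) for EVERY archimedean Weil datum `ω` over `ι𝕎` (tree notion `Weil1964.IsArchWeilDatum`) of a junction whose
`V`-side is definite, the whole group `U(V) = U(P,Q)` acts on the Gaussian by an integer power of `det`:

* `exists_forall_fst_vacuum_eq_det_zpow_smul` — `IsEmpty P ∨ IsEmpty Q` ⇒
  `∃ m : ℤ, ∀ g : U(P,Q), ω (g, 1) h₀ = det(g)^m • h₀` (`det` of the `(P ⊕ Q)`-matrix of `g`; equivalently
  `detVChar m (g,1)`, `…_eq_detVChar_smul`);
* `fst_vacuum_exponent_unique_of_isEmpty_right/left` — the exponent is unique as soon as the non-empty block is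
  non-empty (`UnitaryGroupChar.int_eq_of_det_zpow_eq`, [BröckerTomDieck1985, II Prop. 8.1]);
* **`forall_fst_vacuum_eq_self_iff_of_isEmpty_right/left`** — THE DEFINITE-PLACE DICHOTOMY: with that exponent
  `m`, the Gaussian is FIXED by all of `U(V)` iff `m = 0`;
* §3 the same on the `W`-side (`IsEmpty R ∨ IsEmpty S`, action of `(1, h)`), and §4 the joint form when both
  spaces are definite: `κ` is onto `G_∞`, so `∃ mV mW, ∀ g : G_∞, ω g h₀ = (detVChar mV g · detWChar mW g) • h₀`
  (`exists_forall_vacuum_eq_detChar_smul`), together with the RECORD form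
  `FockVacuumCharacter.forall_fst_vacuum_of_isEmpty_right`: under the cited record
  `(junction P Q R S).FockVacuumCharacter e` ([KonnoKonno2007, Lemma 5.2 p. 73]) with `Q = ∅` the record's datum
  has ALL of `U(V)` acting on the vacuum by `det^{e_P}`.

Provenance / use (Hodge-CM model-construction cell, BINDER-TRIAGE §61, ticket D-5 = (c5) (C-fix∞⊥)): at an
archimedean place `b ≠ ι₁` of the CM field where the hermitian space `V` of PerL is definite, `U(V_b) ≅ U(3)` is
compact and the question «is the pinned Gaussian test vector FIXED by `U(V_b)` under the line pair's Weil
representation» is, by this file, the question «is the datum's exponent `m_b` zero» — an INTEGER attached to the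
archimedean Weil datum (not to the junction: by `JunctionDetCharacters` every integer is realised by some datum over
the same junction).  Nothing here decides that integer for any particular datum.

Kernel only ([folklore] linear algebra over the tree's `exists_vacExponents`); no statement of print is used as a
hypothesis except in the record-form corollary of §4, which CONSUMES the existing record `FockVacuumCharacter`.

References (conventions only): [KonnoKonno2007] K. Konno, T. Konno, Kyushu J. Math. 61 (2007) §3.1 (3.1), Lemma 5.2
p. 73; [Folland1989] G. B. Folland, *Harmonic analysis in phase space*, Prop. (4.39); [BröckerTomDieck1985]
T. Bröcker, T. tom Dieck, *Representations of compact Lie groups*, Ch. II Prop. 8.1.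
-/

set_option autoImplicit false

noncomputable section

open Complex Matrix SchwartzMap
open Literature.Analysis.SegalBargmann Literature.RepresentationTheory.HeisenbergGroup
open Literature.NumberTheory.Weil1964 Literature.RepresentationTheory.CompactGroups
open Literature.NumberTheory.Automorphic Literature.NumberTheory.Automorphic.UnitaryGroup

namespace Literature.RepresentationTheory.KonnoKonno2007

namespace RealDualPair

/-! ## 1. Definite forms: `kV : U(P) × U(Q) → U(P,Q)` is onto when one block is empty

The two surjectivity statements `UForm.kV_surjective_of_isEmpty_right/left` are the tree's
(`JunctionContinuityKAK` §2); we only add the disjunctive form and the determinant of a block-diagonal element. -/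

namespace UForm

section Definite

variable {α β : Type*} [Fintype α] [DecidableEq α] [Fintype β] [DecidableEq β]

/-- **A definite `U(α, β)` (one block empty) is covered by `U(α) × U(β)`.** [cite: Folland1989, Prop (4.39)] -/
theorem kV_surjective_of_isEmpty (h : IsEmpty α ∨ IsEmpty β) : Function.Surjective (kV α β) := by
  rcases h with h | h
  · exact kV_surjective_of_isEmpty_left
  · exact kV_surjective_of_isEmpty_right

/-- `det diag(a, b) = det a · det b` on the image of `kV`. [folklore] -/
theorem det_coe_kV (k : Matrix.unitaryGroup α ℂ × Matrix.unitaryGroup β ℂ) :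
    (((kV α β k : UForm α β) : GL (α ⊕ β) ℂ) : Matrix (α ⊕ β) (α ⊕ β) ℂ).det =
      (k.1 : Matrix α α ℂ).det * (k.2 : Matrix β β ℂ).det := by
  rw [coe_kV, Matrix.det_fromBlocks_zero₂₁]

end Definite

end UForm

/-! ## 2. `V` definite: `U(V)` acts on the vacuum of every archimedean Weil datum by `det^m` -/

section VDefinite

variable {P Q R S : Type*} [Fintype P] [DecidableEq P] [Fintype Q] [DecidableEq Q] [Fintype R]
  [DecidableEq R] [Fintype S] [DecidableEq S]
variable {ω : Representation ℂ (Ginf P Q R S) (SchwartzMap (DPIdx P Q R S → ℝ) ℂ)}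

/-- on `(k, 1)` the four-determinant scalar is `det a ^ e_P · det b ^ e_Q`. [folklore] -/
theorem vacScalar_mk_one (e : VacExponents) (k : Matrix.unitaryGroup P ℂ × Matrix.unitaryGroup Q ℂ) :
    vacScalar e ((k, 1) : DPK P Q R S) = (k.1 : Matrix P P ℂ).det ^ e.eP * (k.2 : Matrix Q Q ℂ).det ^ e.eQ := by
  simp [vacScalar]

/-- on `(1, k)` the four-determinant scalar is `det c ^ e_R · det d ^ e_S`. [folklore] -/
theorem vacScalar_one_mk (e : VacExponents) (k : Matrix.unitaryGroup R ℂ × Matrix.unitaryGroup S ℂ) :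
    vacScalar e ((1, k) : DPK P Q R S) = (k.1 : Matrix R R ℂ).det ^ e.eR * (k.2 : Matrix S S ℂ).det ^ e.eS := by
  simp [vacScalar]

/-- **`V` definite (`P = ∅` or `Q = ∅`): for every archimedean Weil datum over the junction, the WHOLE group
`U(V) = U(P,Q)` acts on the Gaussian by an integer power of `det`.** [cite: Folland1989, Prop (4.39)] -/
theorem exists_forall_fst_vacuum_eq_det_zpow_smul (hV : IsEmpty P ∨ IsEmpty Q)
    (hω : IsArchWeilDatum (ι𝕎 P Q R S) ω) :
    ∃ m : ℤ, ∀ g : UForm P Q,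
      ω (g, 1) (hermitePi 0) = ((((g : GL (P ⊕ Q) ℂ) : Matrix (P ⊕ Q) (P ⊕ Q) ℂ)).det ^ m) • hermitePi 0 := by
  obtain ⟨e, he⟩ := (junction P Q R S).exists_vacExponents hω
  rcases hV with hP | hQ
  · refine ⟨e.eQ, fun g => ?_⟩
    obtain ⟨k, hk⟩ := UForm.kV_surjective_of_isEmpty_left (α := P) (β := Q) g
    have h := he (k, 1)
    rw [junction_κ, ← kV_one_eq_κ, hk] at h
    rw [h, vacScalar_mk_one, ← hk, UForm.det_coe_kV, Matrix.det_isEmpty (A := (k.1 : Matrix P P ℂ)), _root_.one_zpow,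
      one_mul, one_mul]
  · refine ⟨e.eP, fun g => ?_⟩
    obtain ⟨k, hk⟩ := UForm.kV_surjective_of_isEmpty_right (α := P) (β := Q) g
    have h := he (k, 1)
    rw [junction_κ, ← kV_one_eq_κ, hk] at h
    rw [h, vacScalar_mk_one, ← hk, UForm.det_coe_kV, Matrix.det_isEmpty (A := (k.2 : Matrix Q Q ℂ)), _root_.one_zpow,
      mul_one, mul_one]

/-- The same in the currency of `detVChar`: `ω (g, 1) h₀ = χ_V^m (g, 1) • h₀`. [cite: Folland1989, Prop (4.39)] -/
theorem exists_forall_fst_vacuum_eq_detVChar_smul (hV : IsEmpty P ∨ IsEmpty Q)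
    (hω : IsArchWeilDatum (ι𝕎 P Q R S) ω) :
    ∃ m : ℤ, ∀ g : UForm P Q,
      ω (g, 1) (hermitePi 0) = ((detVChar P Q R S m (g, 1) : Circle) : ℂ) • hermitePi 0 := by
  obtain ⟨m, hm⟩ := exists_forall_fst_vacuum_eq_det_zpow_smul hV hω
  exact ⟨m, fun g => by rw [hm g, coe_detVChar]⟩

/-- Uniqueness of the exponent, `Q = ∅`, `P ≠ ∅`. [cite: BrockerTomDieck1985, Ch. II Prop. 8.1] -/
theorem fst_vacuum_exponent_unique_of_isEmpty_right [IsEmpty Q] [Nonempty P] {m m' : ℤ}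
    (hm : ∀ g : UForm P Q,
      ω (g, 1) (hermitePi 0) = ((((g : GL (P ⊕ Q) ℂ) : Matrix (P ⊕ Q) (P ⊕ Q) ℂ)).det ^ m) • hermitePi 0)
    (hm' : ∀ g : UForm P Q,
      ω (g, 1) (hermitePi 0) = ((((g : GL (P ⊕ Q) ℂ) : Matrix (P ⊕ Q) (P ⊕ Q) ℂ)).det ^ m') • hermitePi 0) :
    m = m' :=
  UnitaryGroupChar.int_eq_of_det_zpow_eq fun a => by
    have h := smul_left_injective ℂ (hermitePi_ne_zero (σ := DPIdx P Q R S) 0)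
      ((hm (UForm.kV P Q (a, 1))).symm.trans (hm' (UForm.kV P Q (a, 1))))
    have hdet : ((((UForm.kV P Q (a, 1) : UForm P Q) : GL (P ⊕ Q) ℂ) : Matrix (P ⊕ Q) (P ⊕ Q) ℂ)).det =
        (a : Matrix P P ℂ).det := by
      rw [UForm.det_coe_kV, OneMemClass.coe_one, Matrix.det_one, mul_one]
    simpa only [hdet] using h

/-- Uniqueness of the exponent, `P = ∅`, `Q ≠ ∅`. [cite: BrockerTomDieck1985, Ch. II Prop. 8.1] -/
theorem fst_vacuum_exponent_unique_of_isEmpty_left [IsEmpty P] [Nonempty Q] {m m' : ℤ}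
    (hm : ∀ g : UForm P Q,
      ω (g, 1) (hermitePi 0) = ((((g : GL (P ⊕ Q) ℂ) : Matrix (P ⊕ Q) (P ⊕ Q) ℂ)).det ^ m) • hermitePi 0)
    (hm' : ∀ g : UForm P Q,
      ω (g, 1) (hermitePi 0) = ((((g : GL (P ⊕ Q) ℂ) : Matrix (P ⊕ Q) (P ⊕ Q) ℂ)).det ^ m') • hermitePi 0) :
    m = m' :=
  UnitaryGroupChar.int_eq_of_det_zpow_eq fun b => by
    have h := smul_left_injective ℂ (hermitePi_ne_zero (σ := DPIdx P Q R S) 0)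
      ((hm (UForm.kV P Q (1, b))).symm.trans (hm' (UForm.kV P Q (1, b))))
    have hdet : ((((UForm.kV P Q (1, b) : UForm P Q) : GL (P ⊕ Q) ℂ) : Matrix (P ⊕ Q) (P ⊕ Q) ℂ)).det =
        (b : Matrix Q Q ℂ).det := by
      rw [UForm.det_coe_kV, OneMemClass.coe_one, Matrix.det_one, one_mul]
    simpa only [hdet] using h

/-- **THE DEFINITE-PLACE DICHOTOMY (`Q = ∅`): the Gaussian is FIXED by all of `U(V)` iff the datum's exponent is
`0`.** [cite: BrockerTomDieck1985, Ch. II Prop. 8.1] -/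
theorem forall_fst_vacuum_eq_self_iff_of_isEmpty_right [IsEmpty Q] [Nonempty P] {m : ℤ}
    (hm : ∀ g : UForm P Q,
      ω (g, 1) (hermitePi 0) = ((((g : GL (P ⊕ Q) ℂ) : Matrix (P ⊕ Q) (P ⊕ Q) ℂ)).det ^ m) • hermitePi 0) :
    (∀ g : UForm P Q, ω (g, 1) (hermitePi 0) = hermitePi 0) ↔ m = 0 := by
  refine ⟨fun h => fst_vacuum_exponent_unique_of_isEmpty_right (R := R) (S := S) hm fun g => ?_, fun h g => ?_⟩
  · rw [h g, zpow_zero, one_smul]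
  · rw [hm g, h, zpow_zero, one_smul]

/-- **THE DEFINITE-PLACE DICHOTOMY (`P = ∅`)**: the Gaussian is fixed by all of `U(V)` iff the exponent is `0`.
[cite: BrockerTomDieck1985, Ch. II Prop. 8.1] -/
theorem forall_fst_vacuum_eq_self_iff_of_isEmpty_left [IsEmpty P] [Nonempty Q] {m : ℤ}
    (hm : ∀ g : UForm P Q,
      ω (g, 1) (hermitePi 0) = ((((g : GL (P ⊕ Q) ℂ) : Matrix (P ⊕ Q) (P ⊕ Q) ℂ)).det ^ m) • hermitePi 0) :
    (∀ g : UForm P Q, ω (g, 1) (hermitePi 0) = hermitePi 0) ↔ m = 0 := by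
  refine ⟨fun h => fst_vacuum_exponent_unique_of_isEmpty_left (R := R) (S := S) hm fun g => ?_, fun h g => ?_⟩
  · rw [h g, zpow_zero, one_smul]
  · rw [hm g, h, zpow_zero, one_smul]

end VDefinite

/-! ## 3. `W` definite: `U(W)` acts on the vacuum by `det^{m′}` -/

section WDefinite

variable {P Q R S : Type*} [Fintype P] [DecidableEq P] [Fintype Q] [DecidableEq Q] [Fintype R]
  [DecidableEq R] [Fintype S] [DecidableEq S]
variable {ω : Representation ℂ (Ginf P Q R S) (SchwartzMap (DPIdx P Q R S → ℝ) ℂ)}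

/-- **`W` definite (`R = ∅` or `S = ∅`): the whole group `U(W) = U(R,S)` acts on the Gaussian of every archimedean
Weil datum over the junction by an integer power of `det`.** [cite: Folland1989, Prop (4.39)] -/
theorem exists_forall_snd_vacuum_eq_det_zpow_smul (hW : IsEmpty R ∨ IsEmpty S)
    (hω : IsArchWeilDatum (ι𝕎 P Q R S) ω) :
    ∃ m' : ℤ, ∀ h : UForm R S,
      ω (1, h) (hermitePi 0) = ((((h : GL (R ⊕ S) ℂ) : Matrix (R ⊕ S) (R ⊕ S) ℂ)).det ^ m') • hermitePi 0 := by
  obtain ⟨e, he⟩ := (junction P Q R S).exists_vacExponents hω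
  rcases hW with hR | hS
  · refine ⟨e.eS, fun h => ?_⟩
    obtain ⟨k, hk⟩ := UForm.kV_surjective_of_isEmpty_left (α := R) (β := S) h
    have h1 := he (1, k)
    rw [junction_κ, ← one_kV_eq_κ, hk] at h1
    rw [h1, vacScalar_one_mk, ← hk, UForm.det_coe_kV, Matrix.det_isEmpty (A := (k.1 : Matrix R R ℂ)), _root_.one_zpow,
      one_mul, one_mul]
  · refine ⟨e.eR, fun h => ?_⟩
    obtain ⟨k, hk⟩ := UForm.kV_surjective_of_isEmpty_right (α := R) (β := S) h
    have h1 := he (1, k)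
    rw [junction_κ, ← one_kV_eq_κ, hk] at h1
    rw [h1, vacScalar_one_mk, ← hk, UForm.det_coe_kV, Matrix.det_isEmpty (A := (k.2 : Matrix S S ℂ)), _root_.one_zpow,
      mul_one, mul_one]

/-- The same in the currency of `detWChar`. [cite: Folland1989, Prop (4.39)] -/
theorem exists_forall_snd_vacuum_eq_detWChar_smul (hW : IsEmpty R ∨ IsEmpty S)
    (hω : IsArchWeilDatum (ι𝕎 P Q R S) ω) :
    ∃ m' : ℤ, ∀ h : UForm R S,
      ω (1, h) (hermitePi 0) = ((detWChar P Q R S m' (1, h) : Circle) : ℂ) • hermitePi 0 := by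
  obtain ⟨m', hm⟩ := exists_forall_snd_vacuum_eq_det_zpow_smul hW hω
  exact ⟨m', fun h => by rw [hm h, coe_detWChar]⟩

end WDefinite

/-! ## 4. Both spaces definite: `κ` is onto `G_∞` and the whole group acts on the vacuum by a character -/

section BothDefinite

variable {P Q R S : Type*} [Fintype P] [DecidableEq P] [Fintype Q] [DecidableEq Q] [Fintype R]
  [DecidableEq R] [Fintype S] [DecidableEq S]

/-- **Both `V` and `W` definite: the maximal compact `K_V × K_W` is all of `G_∞`** (`κ` onto). [cite: Folland1989, Prop (4.39)] -/
theorem κ_surjective (hV : IsEmpty P ∨ IsEmpty Q) (hW : IsEmpty R ∨ IsEmpty S) :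
    Function.Surjective (κ P Q R S) := fun g => by
  obtain ⟨k₁, hk₁⟩ := UForm.kV_surjective_of_isEmpty hV g.1
  obtain ⟨k₂, hk₂⟩ := UForm.kV_surjective_of_isEmpty hW g.2
  exact ⟨(k₁, k₂), Prod.ext hk₁ hk₂⟩

variable {ω : Representation ℂ (Ginf P Q R S) (SchwartzMap (DPIdx P Q R S → ℝ) ℂ)}

/-- **Both definite: the WHOLE group `G_∞ = U(V) × U(W)` acts on the Gaussian of every archimedean Weil datum over
the junction by the character `χ_V^{m_V} · χ_W^{m_W}`.** [cite: Folland1989, Prop (4.39)] -/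
theorem exists_forall_vacuum_eq_detChar_smul (hV : IsEmpty P ∨ IsEmpty Q) (hW : IsEmpty R ∨ IsEmpty S)
    (hω : IsArchWeilDatum (ι𝕎 P Q R S) ω) :
    ∃ mV mW : ℤ, ∀ g : Ginf P Q R S,
      ω g (hermitePi 0) =
        (((detVChar P Q R S mV g : Circle) : ℂ) * ((detWChar P Q R S mW g : Circle) : ℂ)) • hermitePi 0 := by
  obtain ⟨mV, hmV⟩ := exists_forall_fst_vacuum_eq_detVChar_smul hV hω
  obtain ⟨mW, hmW⟩ := exists_forall_snd_vacuum_eq_detWChar_smul hW hω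
  refine ⟨mV, mW, fun g => ?_⟩
  have hg : g = (g.1, 1) * (1, g.2) := Prod.ext (mul_one _).symm (one_mul _).symm
  have hV1 : detVChar P Q R S mV g = detVChar P Q R S mV (g.1, 1) := by
    apply Circle.ext; rw [coe_detVChar, coe_detVChar]
  have hW1 : detWChar P Q R S mW g = detWChar P Q R S mW (1, g.2) := by
    apply Circle.ext; rw [coe_detWChar, coe_detWChar]
  conv_lhs => rw [hg, map_mul]
  rw [Module.End.mul_apply, hmW, map_smul, hmV, smul_smul, hV1, hW1, mul_comm]

/-- **RECORD FORM (`Q = ∅`)**: under the cited record `(junction P Q R S).FockVacuumCharacter e`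
([KonnoKonno2007, Lemma 5.2 p. 73]: its archimedean Weil datum exists and `K_V × K_W` acts on the vacuum by
`vacChar e`), the record's datum has ALL of `U(V) = U(P, ∅)` acting on the Gaussian by `det^{e_P}`.
[cite: KonnoKonno2007, Lemma 5.2 (i)/(ii) p. 73] -/
theorem _root_.Literature.RepresentationTheory.KonnoKonno2007.RealDualPairJunction.FockVacuumCharacter.forall_fst_vacuum_of_isEmpty_right
    [IsEmpty Q] {e : VacExponents} (h : (junction P Q R S).FockVacuumCharacter e) :
    ∃ ω : Representation ℂ (Ginf P Q R S) (SchwartzMap (DPIdx P Q R S → ℝ) ℂ), IsArchWeilDatum (ι𝕎 P Q R S) ω ∧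
      ∀ g : UForm P Q,
        ω (g, 1) (hermitePi 0) = ((((g : GL (P ⊕ Q) ℂ) : Matrix (P ⊕ Q) (P ⊕ Q) ℂ)).det ^ e.eP) • hermitePi 0 := by
  obtain ⟨ω, hω, he⟩ := h
  refine ⟨ω, hω, fun g => ?_⟩
  obtain ⟨k, hk⟩ := UForm.kV_surjective_of_isEmpty_right (α := P) (β := Q) g
  have h1 := he (k, 1)
  rw [junction_κ, ← kV_one_eq_κ, hk] at h1
  rw [h1, vacScalar_mk_one, ← hk, UForm.det_coe_kV, Matrix.det_isEmpty (A := (k.2 : Matrix Q Q ℂ)), _root_.one_zpow,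
    mul_one, mul_one]

/-- **RECORD FORM (`P = ∅`)**: under the record with `V` negative definite in the frame, all of `U(V) = U(∅, Q)`
acts on the Gaussian by `det^{e_Q}`. [cite: KonnoKonno2007, Lemma 5.2 (i)/(ii) p. 73] -/
theorem _root_.Literature.RepresentationTheory.KonnoKonno2007.RealDualPairJunction.FockVacuumCharacter.forall_fst_vacuum_of_isEmpty_left
    [IsEmpty P] {e : VacExponents} (h : (junction P Q R S).FockVacuumCharacter e) :
    ∃ ω : Representation ℂ (Ginf P Q R S) (SchwartzMap (DPIdx P Q R S → ℝ) ℂ), IsArchWeilDatum (ι𝕎 P Q R S) ω ∧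
      ∀ g : UForm P Q,
        ω (g, 1) (hermitePi 0) = ((((g : GL (P ⊕ Q) ℂ) : Matrix (P ⊕ Q) (P ⊕ Q) ℂ)).det ^ e.eQ) • hermitePi 0 := by
  obtain ⟨ω, hω, he⟩ := h
  refine ⟨ω, hω, fun g => ?_⟩
  obtain ⟨k, hk⟩ := UForm.kV_surjective_of_isEmpty_left (α := P) (β := Q) g
  have h1 := he (k, 1)
  rw [junction_κ, ← kV_one_eq_κ, hk] at h1
  rw [h1, vacScalar_mk_one, ← hk, UForm.det_coe_kV, Matrix.det_isEmpty (A := (k.1 : Matrix P P ℂ)), _root_.one_zpow,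
    one_mul, one_mul]

end BothDefinite

end RealDualPair

end Literature.RepresentationTheory.KonnoKonno2007
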